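import Literature.NumberTheory.EllipticCurves.TateCurve.UniformizationHolds
import Mathlib.RingTheory.RootsOfUnity.AlgebraicallyClosed
import Mathlib.RingTheory.PrincipalIdealDomain
import Mathlib.Data.Set.Card
import HarnessLib

/-!
# [GenEll] Lemma 3.2 (i) (Local Rank One Subgroups of `l`-Torsion) for the Tate curve, PROVED

S. Mochizuki, *Arithmetic elliptic curves in general position*, Math. J. Okayama Univ. **52** (2010)
[MochizukiGenEll2010], §3 "the local theory at nonarchimedean primes", journal pp. 16–17 (kurims p. 15),
read on the page. The setting: `K` a finite extension of `ℚ_p`, `E → Spec(O_K)` a one-dimensional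
semi-abelian scheme with proper generic fibre and special fibre `𝔾_m` (i.e. `E_K` is a Tate curve `E_q`,
`q = q_E ∈ 𝔪_K` the Tate parameter), `l` a prime, `M_l(E)` the mod-`l` Tate module with its natural exact
sequence of `G_K`-modules `0 → 𝔽_l(1) → M_l(E) → 𝔽_l → 0`; "the extension class associated to this
exact sequence is precisely that obtained by extracting an `l`-th root of the Tate parameter
`q_E ∈ 𝔪_K`", so that "the above exact sequence splits if
and only if `q_E` has an `l`-th root in `K`. Note that in order for this to happen, it is necessary that
`v_K(q_E)` be divisible by `l`. In particular, we have the following well-known result.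

> **Lemma 3.2 (Local Rank One Subgroups of `l`-Torsion).** (i) Let `N ⊆ M_l(E)` be a one-dimensional
> `𝔽_l`-subspace which is stabilized by `G_K`. Then either `v_K(q_E) ∈ l·ℤ`, or `N` is equal to the
> submodule `𝔽_l(1) ⊆ M_l(E)` of the above exact sequence."

(Proof omitted in print: "well-known"; part (ii) is the companion file `RankOneTorsionQuotient.lean`.)
DAG node `GenEll:Lem3.2(i)` of the abc-iut cell (layer S); the tree's proof of [GenEll] Lem. 3.5
(`GenEllLemma35Proofs.lean`) deliberately bypasses Lemma 3.2 through the modular equation, and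
`GenEllMell.lean` records Lemma 3.2 as "not here" — this file supplies (i), OVER THE TREE'S TATE CURVE:
`tateCurve q` over a complete ultrametric field `K` of characteristic `0`, `0 < ‖q‖ < 1`,
`E_q(K̄) = geomPoints (tateCurve q)` with its `Field.absoluteGaloisGroup K`-action, and Tate's
uniformisation `φ : K̄^× → E_q(K̄)` (surjective, kernel `q^ℤ`, `G_K`-equivariant), which is the tree's
THEOREM `uniformization_holds` (Silverman ATAEC V.3.1 (c),(d)). In this currency
`M_l(E) = E_q(K̄)[l] = φ({u : u^l ∈ q^ℤ})` and `𝔽_l(1) = φ(μ_l(K̄))`.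

What is proved (theorems only; no definition, no named fact, nothing conditional):

* `stableSubgroup_eq_image_rootsOfUnity_or_exists_pow_eq` — **(i), for ANY map `φ` with the three
  uniformisation clauses** (surjective onto a `G_K`-module `M`, kernel `q^ℤ`, equivariant; `K` any normed
  field of characteristic `0`, `0 < ‖q‖ < 1`): a `G_K`-stable subgroup `N ≤ M` of prime order `l` is
  `φ(μ_l)` unless `q` is an `l`-th power IN `K` — which is (slightly more than) print's alternative
  "`v_K(q_E) ∈ l·ℤ`" (`exists_valuation_eq_pow_of_exists_pow_eq`: then `v(q) = v(r)^l` for every valuation).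
  Proof (the printed mechanism, splitting ⟺ `l`-th root): if some `P ∈ N` is not in `φ(μ_l)`, then
  `N ∩ φ(μ_l) = 0` (prime order), and for `σ ∈ G_K`, `σP − P = φ(σw/w)` (`P = φ(w)`, `w^l = q^m`) lies in
  `N ∩ φ(μ_l)`, so `P` is `G_K`-fixed, hence `P = φ(u)` with `u ∈ K^×` (the tree's descent
  `exists_mem_of_fixed`), `u^l = q^{m'}` with `l ∤ m'`, and Bezout makes `q` an `l`-th power in `K`.
* `exists_subgroup_coe_eq_image_rootsOfUnity` — `𝔽_l(1) = φ(μ_l)` IS a `G_K`-stable subgroup of order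
  exactly `l` (`#μ_l(K̄) = l`, `μ_l ∩ q^ℤ = 1`): the sub of the exact sequence.
* `exists_stable_subgroup_card_eq`, `existsUnique_stable_subgroup_card_eq`, `GenEll_lemma32_i` — (i) for
  `tateCurve q` INTRINSICALLY (no `φ` in the statement): `E_q(K̄)` has a `G_K`-stable subgroup of order `l`,
  and if `q ∉ (K^×)^l` it has EXACTLY ONE (so every stable rank-one `N` is `𝔽_l(1)`).

References: [MochizukiGenEll2010] §3, Lemma 3.2, Def. 3.3 (journal pp. 16–17); [SilvermanATAEC1994]
J. H. Silverman, *Advanced Topics in the Arithmetic of Elliptic Curves*, GTM 151, Thm. V.3.1 (c),(d)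
(PDF pp. 394–399) — the uniformisation and its Galois descent, tree files `Uniformization*.lean`.
abc-iut cell, campaign S, seat abc-iut-S-d3 (gen 3); classical, takes no side on anything disputed.
-/

noncomputable section

open scoped Classical

namespace Literature.NumberTheory.EllipticCurves.TateCurve

open Field WeierstrassCurve SteinWuthrich2013

universe u v

section Shape

variable {K : Type u} [NormedField K] [CharZero K] {q : K}
  {M : Type v} [AddCommGroup M] [MulAction (absoluteGaloisGroup K) M]

/-- **[GenEll] Lemma 3.2 (i), for any `q^ℤ`-uniformisation.** Let `K` be a normed field of
characteristic `0`, `q ∈ K` with `0 < ‖q‖ < 1`, `M` a `G_K`-module and `φ : K̄^× → M` a surjective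
homomorphism with kernel `q^ℤ`, compatible with `G_K = Gal(K̄/K)` (the three clauses of Tate's
uniformisation, Silverman ATAEC V.3.1 (c),(d)). Let `l` be a prime and `N ≤ M` a `G_K`-stable subgroup of
order `l` ("a one-dimensional `𝔽_l`-subspace of `M_l(E)` stabilized by `G_K`"). Then EITHER `q = r^l` for
some `r ∈ K` (whence "`v_K(q_E) ∈ l·ℤ`"), OR `N = φ(μ_l(K̄))` ("`N` is equal to the submodule `𝔽_l(1)`").
Proof: see the module docstring (prime order ⇒ `N ∩ φ(μ_l) = 0` ⇒ a point of `N ∖ φ(μ_l)` is `G_K`-fixed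
⇒ it is `φ(u)` with `u ∈ K^×`, `u^l = q^{m}`, `l ∤ m` ⇒ Bezout). [cite: MochizukiGenEll2010, Lem 3.2 (i) p.15] -/
theorem stableSubgroup_eq_image_rootsOfUnity_or_exists_pow_eq (hq0 : q ≠ 0) (hq : ‖q‖ < 1)
    (φ : Additive (AlgebraicClosure K)ˣ →+ M) (hsurj : Function.Surjective φ)
    (hker : ∀ u : (AlgebraicClosure K)ˣ, φ (Additive.ofMul u) = 0 ↔
      ∃ n : ℤ, (u : AlgebraicClosure K) = algebraMap K (AlgebraicClosure K) q ^ n)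
    (hequiv : ∀ (σ : absoluteGaloisGroup K) (u : (AlgebraicClosure K)ˣ),
      σ • φ (Additive.ofMul u) =
        φ (Additive.ofMul (Units.map
          (absoluteGaloisGroup.toAlgEquiv K σ : AlgebraicClosure K →* AlgebraicClosure K) u)))
    {l : ℕ} (hl : l.Prime) (N : AddSubgroup M) (hN : Nat.card N = l)
    (hstab : ∀ σ : absoluteGaloisGroup K, ∀ x ∈ N, σ • x ∈ N) :
    (∃ r : K, r ^ l = q) ∨
      (N : Set M) = (fun u : (AlgebraicClosure K)ˣ => φ (Additive.ofMul u)) '' {u | u ^ l = 1} := by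
  set Kb := AlgebraicClosure K
  set qb : Kb := algebraMap K Kb q with hqb_def
  have hqb0 : qb ≠ 0 := (_root_.map_ne_zero _).mpr hq0
  set L1 : Set M := (fun u : Kbˣ => φ (Additive.ofMul u)) '' {u | u ^ l = 1} with hL1_def
  have hl0 : 0 < l := hl.pos
  haveI : NeZero l := ⟨hl.ne_zero⟩
  haveI hNfin : Finite N := Nat.finite_of_card_ne_zero (by rw [hN]; exact hl.ne_zero)
  -- every element of `N` is killed by `l`
  have hNl : ∀ x ∈ N, l • x = 0 := by
    intro x hx
    have h := card_nsmul_eq_zero' (x := (⟨x, hx⟩ : N))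
    rw [hN] at h
    exact congrArg Subtype.val h
  -- membership in `L1`
  have memL1 : ∀ u : Kbˣ, u ^ l = 1 → φ (Additive.ofMul u) ∈ L1 := fun u hu => ⟨u, hu, rfl⟩
  -- `L1` is finite with at most `l` elements
  have hroots_fin : ({u : Kbˣ | u ^ l = 1} : Set Kbˣ).Finite ∧ ({u : Kbˣ | u ^ l = 1} : Set Kbˣ).ncard ≤ l := by
    have hE : ({u : Kbˣ | u ^ l = 1} : Set Kbˣ) = (rootsOfUnity l Kb : Set Kbˣ) := by
      ext u
      simp [mem_rootsOfUnity]
    rw [hE]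
    have hfin : Finite (rootsOfUnity l Kb) := inferInstance
    refine ⟨Set.finite_coe_iff.mp hfin, ?_⟩
    rw [← Nat.card_coe_set_eq]
    exact card_rootsOfUnity Kb l
  have hL1fin : L1.Finite := hroots_fin.1.image _
  have hL1card : L1.ncard ≤ l := (Set.ncard_image_le hroots_fin.1).trans hroots_fin.2
  by_cases hcase : (N : Set M) ⊆ L1
  · right
    refine Set.eq_of_subset_of_ncard_le hcase ?_ hL1fin
    have : (N : Set M).ncard = l := by rw [← Nat.card_coe_set_eq]; exact hN
    rw [this]
    exact hL1card
  · left
    obtain ⟨P, hPN, hPL⟩ := Set.not_subset.mp hcase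
    -- `N ∩ L1 = {0}`: a nonzero element of `N ∩ L1` would generate `N` (prime order), forcing `P ∈ L1`
    have hmeet : ∀ Q ∈ N, Q ∈ L1 → Q = 0 := by
      intro Q hQN hQL
      by_contra hQ0
      have hle : AddSubgroup.zmultiples Q ≤ N := (AddSubgroup.zmultiples_le).mpr hQN
      have hQl : l • Q = 0 := hNl Q hQN
      have hord : addOrderOf Q = l := by
        have hdvd : addOrderOf Q ∣ l := addOrderOf_dvd_of_nsmul_eq_zero hQl
        rcases (Nat.dvd_prime hl).mp hdvd with h1 | h2
        · exact absurd (AddMonoid.addOrderOf_eq_one_iff.mp h1) hQ0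
        · exact h2
      have heq : AddSubgroup.zmultiples Q = N :=
        AddSubgroup.eq_of_le_of_card_ge hle (by rw [hN, Nat.card_zmultiples, hord])
      have hPz : P ∈ AddSubgroup.zmultiples Q := by rw [heq]; exact hPN
      obtain ⟨k, hk⟩ := AddSubgroup.mem_zmultiples_iff.mp hPz
      obtain ⟨ζ, hζ, hζQ⟩ := hQL
      apply hPL
      refine ⟨ζ ^ k, ?_, ?_⟩
      · show (ζ ^ k) ^ l = 1
        rw [← zpow_natCast, ← zpow_mul, mul_comm, zpow_mul, zpow_natCast, hζ, one_zpow]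
      · show φ (Additive.ofMul (ζ ^ k)) = P
        have hζQ' : φ (Additive.ofMul ζ) = Q := hζQ
        rw [ofMul_zpow, map_zsmul, hζQ', hk]
    -- a lift `w` of `P`, with `w ^ l = q ^ m`
    obtain ⟨a, ha⟩ := hsurj P
    set w : Kbˣ := Additive.toMul a with hw_def
    have hw : φ (Additive.ofMul w) = P := by simpa [hw_def] using ha
    have hPl : l • P = 0 := hNl P hPN
    have hwl0 : φ (Additive.ofMul (w ^ l)) = 0 := by rw [ofMul_pow, map_nsmul, hw, hPl]
    obtain ⟨m, hm⟩ := (hker _).mp hwl0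
    rw [Units.val_pow_eq_pow_val] at hm
    -- `P` is fixed by `G_K`
    have hfix : ∀ σ : absoluteGaloisGroup K, σ • P = P := by
      intro σ
      set τ := absoluteGaloisGroup.toAlgEquiv K σ with hτ_def
      have hD : σ • P - P = φ (Additive.ofMul (Units.map (τ : Kb →* Kb) w * w⁻¹)) := by
        rw [ofMul_mul, ofMul_inv, map_add, map_neg, ← hw, hequiv, sub_eq_add_neg]
      have hζ : (Units.map (τ : Kb →* Kb) w * w⁻¹) ^ l = 1 := by
        ext
        rw [Units.val_pow_eq_pow_val, Units.val_mul, Units.coe_map, MonoidHom.coe_coe, Units.val_one,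
          mul_pow, ← map_pow, hm, Units.val_inv_eq_inv_val, inv_pow, hm, map_zpow₀, hqb_def,
          AlgEquiv.commutes, mul_inv_cancel₀ (zpow_ne_zero m hqb0)]
      have hDN : σ • P - P ∈ N := N.sub_mem (hstab σ P hPN) hPN
      have hDL : σ • P - P ∈ L1 := hD ▸ memL1 _ hζ
      exact sub_eq_zero.mp (hmeet _ hDN hDL)
    -- hence `P = φ(u)` with `u ∈ K`
    obtain ⟨u, huK, huP⟩ :=
      exists_mem_of_fixed hq0 hq φ hsurj hker hequiv ⊥ P (fun σ _ => hfix σ)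
    obtain ⟨u₀, hu₀⟩ := IntermediateField.mem_bot.mp huK
    have hul0 : φ (Additive.ofMul (u ^ l)) = 0 := by rw [ofMul_pow, map_nsmul, huP, hPl]
    obtain ⟨m', hm'⟩ := (hker _).mp hul0
    rw [Units.val_pow_eq_pow_val] at hm'
    have hu₀0 : u₀ ≠ 0 := by
      rintro rfl
      apply u.ne_zero
      rw [← hu₀, map_zero]
    have hu₀l : u₀ ^ l = q ^ m' := by
      apply (algebraMap K Kb).injective
      rw [map_pow, hu₀, hm', map_zpow₀]
    -- `l ∤ m'`, for otherwise `P ∈ L1`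
    have hndvd : ¬ (l : ℤ) ∣ m' := by
      rintro ⟨c, hc⟩
      apply hPL
      refine ⟨u * (Units.mk0 qb hqb0) ^ (-c), ?_, ?_⟩
      · show (u * Units.mk0 qb hqb0 ^ (-c)) ^ l = 1
        ext
        rw [Units.val_pow_eq_pow_val, Units.val_mul, Units.val_zpow_eq_zpow_val, Units.val_mk0,
          mul_pow, hm', hc, ← zpow_natCast (qb ^ (-c)), ← zpow_mul, ← zpow_add₀ hqb0, Units.val_one]
        convert zpow_zero qb using 2
        ring
      · show φ (Additive.ofMul (u * Units.mk0 qb hqb0 ^ (-c))) = P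
        have h1 : φ (Additive.ofMul (Units.mk0 qb hqb0)) = 0 := (hker _).mpr ⟨1, by simp⟩
        rw [ofMul_mul, map_add, huP, ofMul_zpow, map_zsmul, h1, smul_zero, add_zero]
    -- Bezout: `q` is an `l`-th power in `K`
    have hcop : IsCoprime (l : ℤ) m' :=
      (Nat.prime_iff_prime_int.mp hl).irreducible.coprime_iff_not_dvd.mpr hndvd
    obtain ⟨a, b, hab⟩ := hcop
    refine ⟨q ^ a * u₀ ^ b, ?_⟩
    rw [mul_pow, ← zpow_natCast (u₀ ^ b) l, ← zpow_mul, mul_comm b, zpow_mul, zpow_natCast, hu₀l,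
      ← zpow_mul, ← zpow_natCast (q ^ a) l, ← zpow_mul, ← zpow_add₀ hq0]
    convert zpow_one q using 2
    linear_combination hab

/-- **The submodule `𝔽_l(1) ⊆ M_l(E)`** ([GenEll] §3, the exact sequence `0 → 𝔽_l(1) → M_l(E) → 𝔽_l → 0`
preceding Lemma 3.2): for a `q^ℤ`-uniformisation `φ : K̄^× → M` (kernel `q^ℤ`, `G_K`-equivariant; `K` a
normed field of characteristic `0`, `0 < ‖q‖ < 1`) and `0 < l`, the image `φ(μ_l(K̄))` of the `l`-th roots
of unity is a `G_K`-STABLE subgroup of `M` of order EXACTLY `l` (`#μ_l(K̄) = l` as `K̄` is algebraically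
closed of characteristic `0`; `φ` is injective on `μ_l` since `μ_l ∩ q^ℤ = 1`, `q` not being a root of
unity). [cite: MochizukiGenEll2010, §3 Lem 3.2 p.15] -/
theorem exists_subgroup_coe_eq_image_rootsOfUnity (hq0 : q ≠ 0) (hq : ‖q‖ < 1)
    (φ : Additive (AlgebraicClosure K)ˣ →+ M)
    (hker : ∀ u : (AlgebraicClosure K)ˣ, φ (Additive.ofMul u) = 0 ↔
      ∃ n : ℤ, (u : AlgebraicClosure K) = algebraMap K (AlgebraicClosure K) q ^ n)
    (hequiv : ∀ (σ : absoluteGaloisGroup K) (u : (AlgebraicClosure K)ˣ),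
      σ • φ (Additive.ofMul u) =
        φ (Additive.ofMul (Units.map
          (absoluteGaloisGroup.toAlgEquiv K σ : AlgebraicClosure K →* AlgebraicClosure K) u)))
    {l : ℕ} (hl : 0 < l) :
    ∃ N₀ : AddSubgroup M,
      (N₀ : Set M) = (fun u : (AlgebraicClosure K)ˣ => φ (Additive.ofMul u)) '' {u | u ^ l = 1} ∧
      Nat.card N₀ = l ∧ ∀ σ : absoluteGaloisGroup K, ∀ x ∈ N₀, σ • x ∈ N₀ := by
  set Kb := AlgebraicClosure K
  set qb : Kb := algebraMap K Kb q with hqb_def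
  haveI : NeZero l := ⟨hl.ne'⟩
  haveI : NeZero (l : K) := ⟨Nat.cast_ne_zero.mpr hl.ne'⟩
  let N₀ : AddSubgroup M :=
    { carrier := (fun u : Kbˣ => φ (Additive.ofMul u)) '' {u | u ^ l = 1}
      zero_mem' := ⟨1, by simp, by simp⟩
      add_mem' := by
        rintro _ _ ⟨u, hu, rfl⟩ ⟨v, hv, rfl⟩
        refine ⟨u * v, ?_, ?_⟩
        · show (u * v) ^ l = 1
          rw [mul_pow, show u ^ l = 1 from hu, show v ^ l = 1 from hv, one_mul]
        · show φ (Additive.ofMul (u * v)) = _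
          rw [ofMul_mul, map_add]
      neg_mem' := by
        rintro _ ⟨u, hu, rfl⟩
        refine ⟨u⁻¹, ?_, ?_⟩
        · show u⁻¹ ^ l = 1
          rw [inv_pow, show u ^ l = 1 from hu, inv_one]
        · show φ (Additive.ofMul u⁻¹) = _
          rw [ofMul_inv, map_neg] }
  refine ⟨N₀, rfl, ?_, ?_⟩
  · -- cardinality: `φ` is injective on `μ_l` (`q^ℤ ∩ μ_l = 1`) and `#μ_l(K̄) = l`
    have hinj : Set.InjOn (fun u : Kbˣ => φ (Additive.ofMul u)) {u | u ^ l = 1} := by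
      intro u hu v hv huv
      have hu' : u ^ l = 1 := hu
      have hv' : v ^ l = 1 := hv
      have huv' : φ (Additive.ofMul u) = φ (Additive.ofMul v) := huv
      have h0 : φ (Additive.ofMul (u * v⁻¹)) = 0 := by
        rw [ofMul_mul, ofMul_inv, map_add, map_neg, huv', add_neg_cancel]
      obtain ⟨n, hn⟩ := (hker _).mp h0
      have hnl : (fun k : ℤ ↦ algebraMap K Kb q ^ k) (n * l) = (fun k : ℤ ↦ algebraMap K Kb q ^ k) 0 := by
        show qb ^ (n * l) = qb ^ (0 : ℤ)
        rw [zpow_zero, zpow_mul, zpow_natCast, ← hn, ← Units.val_pow_eq_pow_val, mul_pow, hu', inv_pow, hv',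
          inv_one, mul_one, Units.val_one]
      have hnl' : n * l = 0 := zpow_algebraMap_injective hq0 hq hnl
      have hn0 : n = 0 := by
        rcases mul_eq_zero.mp hnl' with h | h
        · exact h
        · exact absurd (by exact_mod_cast h : l = 0) hl.ne'
      rw [hn0, zpow_zero] at hn
      have h1 : u * v⁻¹ = 1 := Units.ext hn
      exact mul_inv_eq_one.mp h1
    have hE : ({u : Kbˣ | u ^ l = 1} : Set Kbˣ) = (rootsOfUnity l Kb : Set Kbˣ) := by
      ext u
      simp [mem_rootsOfUnity]
    rw [← SetLike.coe_sort_coe, Nat.card_coe_set_eq]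
    show ((fun u : Kbˣ => φ (Additive.ofMul u)) '' {u | u ^ l = 1}).ncard = l
    rw [hinj.ncard_image, hE, ← Nat.card_coe_set_eq]
    exact HasEnoughRootsOfUnity.natCard_rootsOfUnity Kb l
  · -- stability under `G_K`: `σ(μ_l) = μ_l`
    rintro σ _ ⟨u, hu, rfl⟩
    refine ⟨Units.map (absoluteGaloisGroup.toAlgEquiv K σ : Kb →* Kb) u, ?_, (hequiv σ u).symm⟩
    show (Units.map (absoluteGaloisGroup.toAlgEquiv K σ : Kb →* Kb) u) ^ l = 1
    rw [← map_pow, show u ^ l = 1 from hu, map_one]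

end Shape

section Valuation

variable {K : Type u} [Field K] {q : K}

/-- The alternative of [GenEll] Lemma 3.2 (i) as printed: if `q = r^l` in `K` then `v(q) = v(r)^l ∈ l·Γ`
for EVERY valuation `v` of `K` ("`v_K(q_E) ∈ l·ℤ`"; "in order for [`q_E` to have an `l`-th root in `K`],
it is necessary that `v_K(q_E)` be divisible by `l`", journal p. 17). [cite: MochizukiGenEll2010, §3 p.15] -/
theorem exists_valuation_eq_pow_of_exists_pow_eq {Γ₀ : Type*} [LinearOrderedCommGroupWithZero Γ₀]
    (v : Valuation K Γ₀) {l : ℕ} (h : ∃ r : K, r ^ l = q) : ∃ γ : Γ₀, v q = γ ^ l := by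
  obtain ⟨r, rfl⟩ := h
  exact ⟨v r, map_pow v r l⟩

end Valuation

section TateCurve

variable {K : Type u} [NontriviallyNormedField K] [CompleteSpace K] [IsUltrametricDist K]
  [CharZero K] {q : K}

/-- **`𝔽_l(1) ⊆ E_q[l]` for the tree's Tate curve**: for `K` complete ultrametric of characteristic `0`,
`0 < ‖q‖ < 1` and `0 < l`, the `G_K`-module `E_q(K̄) = geomPoints (tateCurve q)` has a `G_K`-stable
subgroup of order `l` — namely `φ(μ_l)` for Tate's uniformisation `φ` (the tree's theorem
`uniformization_holds`, Silverman ATAEC V.3.1 (c),(d)); the statement is intrinsic (no `φ`).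
[cite: MochizukiGenEll2010, §3 Lem 3.2 p.15] -/
theorem exists_stable_subgroup_card_eq (hq0 : q ≠ 0) (hq : ‖q‖ < 1) {l : ℕ} (hl : 0 < l) :
    ∃ N : AddSubgroup (geomPoints (tateCurve q)),
      Nat.card N = l ∧ ∀ σ : absoluteGaloisGroup K, ∀ x ∈ N, σ • x ∈ N := by
  obtain ⟨φ, -, hker, hequiv, -⟩ := uniformization_holds q hq0 hq
  obtain ⟨N₀, -, hcard, hstab⟩ := exists_subgroup_coe_eq_image_rootsOfUnity hq0 hq φ hker hequiv hl
  exact ⟨N₀, hcard, hstab⟩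

/-- **[GenEll] Lemma 3.2 (i) for the Tate curve, intrinsic form**: if `q` is NOT an `l`-th power in `K`
(`l` prime; in particular whenever `l ∤ v_K(q)`), then `E_q(K̄) = geomPoints (tateCurve q)` has EXACTLY ONE
`G_K`-stable subgroup of order `l` (it is `𝔽_l(1) = φ(μ_l)`: existence `exists_subgroup_coe_eq_image_rootsOfUnity`,
uniqueness `stableSubgroup_eq_image_rootsOfUnity_or_exists_pow_eq`, both at Tate's uniformisation
`uniformization_holds`). [cite: MochizukiGenEll2010, Lem 3.2 (i) p.15] -/
theorem existsUnique_stable_subgroup_card_eq (hq0 : q ≠ 0) (hq : ‖q‖ < 1) {l : ℕ} (hl : l.Prime)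
    (hroot : ¬ ∃ r : K, r ^ l = q) :
    ∃! N : AddSubgroup (geomPoints (tateCurve q)),
      Nat.card N = l ∧ ∀ σ : absoluteGaloisGroup K, ∀ x ∈ N, σ • x ∈ N := by
  obtain ⟨φ, hsurj, hker, hequiv, -⟩ := uniformization_holds q hq0 hq
  obtain ⟨N₀, hN₀, hcard, hstab⟩ :=
    exists_subgroup_coe_eq_image_rootsOfUnity hq0 hq φ hker hequiv hl.pos
  refine ⟨N₀, ⟨hcard, hstab⟩, ?_⟩
  rintro N ⟨hN, hNstab⟩
  rcases stableSubgroup_eq_image_rootsOfUnity_or_exists_pow_eq hq0 hq φ hsurj hker hequiv hl N hN hNstab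
    with h | h
  · exact absurd h hroot
  · exact SetLike.coe_injective (h.trans hN₀.symm)

/-- **[GenEll] Lemma 3.2 (i) (Local Rank One Subgroups of `l`-Torsion)** for the Tate curve `E_q` over a
complete ultrametric field `K` of characteristic `0` (`0 < ‖q‖ < 1`), `l` prime: a `G_K`-stable subgroup
`N ≤ E_q(K̄)` of order `l` ("a one-dimensional `𝔽_l`-subspace of `M_l(E)` stabilized by `G_K`") forces
EITHER `q ∈ (K^×)^l` (so "`v_K(q_E) ∈ l·ℤ`", cf. `exists_valuation_eq_pow_of_exists_pow_eq`) OR `N` is THE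
unique such subgroup, i.e. `N = 𝔽_l(1)` (`existsUnique_stable_subgroup_card_eq`,
`exists_subgroup_coe_eq_image_rootsOfUnity`). DAG node GenEll:Lem3.2(i). [cite: MochizukiGenEll2010, Lem 3.2 (i) p.15] -/
theorem GenEll_lemma32_i (hq0 : q ≠ 0) (hq : ‖q‖ < 1) {l : ℕ} (hl : l.Prime)
    (N : AddSubgroup (geomPoints (tateCurve q))) (hN : Nat.card N = l)
    (hstab : ∀ σ : absoluteGaloisGroup K, ∀ x ∈ N, σ • x ∈ N) :
    (∃ r : K, r ^ l = q) ∨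
      ∀ N' : AddSubgroup (geomPoints (tateCurve q)), Nat.card N' = l →
        (∀ σ : absoluteGaloisGroup K, ∀ x ∈ N', σ • x ∈ N') → N' = N := by
  by_cases hroot : ∃ r : K, r ^ l = q
  · exact Or.inl hroot
  · right
    intro N' hN' hstab'
    exact (existsUnique_stable_subgroup_card_eq hq0 hq hl hroot).unique ⟨hN', hstab'⟩ ⟨hN, hstab⟩

end TateCurve

end Literature.NumberTheory.EllipticCurves.TateCurve

end
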